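import Mathlib.AlgebraicGeometry.EllipticCurve.Projective.Formula
import HarnessLib

/-!
# A second addition law of bidegree `(2, 2)` for Weierstrass curves (after Bosma–Lenstra)

Mathlib's `WeierstrassCurve.Projective.addXYZ P Q = (addX, addY, addZ)` is an addition law of
bidegree `(2, 2)` on the plane cubic `E : F = 0` of a Weierstrass curve: for point representatives
`P, Q` on `E` it is a representative of `P + Q` whenever it is non-zero, and it vanishes exactly when
`P` and `Q` represent the same point (`addXYZ_self`, `addXYZ_of_Z_eq_zero_left/right`,
`addXYZ_of_X_eq`). By Bosma–Lenstra (1995), Theorem 2, the addition laws of bidegree `(2, 2)` on a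
Weierstrass curve form a three-dimensional space, the law attached to a point `(a : b : c) ∈ ℙ²`
vanishing at `(P, Q)` iff `P − Q` lies on the line `aX + bY + cZ = 0`; Mathlib's law is the one
of `(0 : 0 : 1)` (the line `Z = 0` meets `E` only in `O`), and together with the law of
`(0 : 1 : 0)` it forms a **complete system** (the line `Y = 0` does not pass through `O`).

This file records such a second law `add₂XYZ P Q = (add₂X, add₂Y, add₂Z)` (bidegree `(2, 2)`,
weights `(11, 12, 9)` for the grading `wt X = 2, wt Y = 3, wt Z = 0, wt aᵢ = i`), obtained by
computer algebra as an element of that three-dimensional space normalised by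
`add₂XYZ (P, P) ≡ dblXYZ P (mod F(P))`, and **proves** the identities that make it usable:

* `add₂X_smul`, `add₂Y_smul`, `add₂Z_smul`, `add₂XYZ_smul`: bihomogeneity of bidegree `(2, 2)`;
* `add₂X_self`, `add₂Y_self`, `add₂Z_self`, `add₂XYZ_self`: **on the diagonal the law is Mathlib's
  doubling law**, `add₂XYZ P P = dblXYZ P` for `P` on the curve — so it does not vanish at
  `(P, P)` for nonsingular `P` (`dblXYZ P` represents `2P`);
* the proportionality with Mathlib's law on `E × E`
  (`add₂X P Q * addZ P Q = add₂Z P Q * addX P Q`, …) is in the sequel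
  `WeierstrassAddLawTwoProportional`.

All proofs are `ring1` / `linear_combination` with explicit cofactors (the certificates were found
by exact linear algebra over `ℚ` and are verified here by the kernel).

## References

* [BosmaLenstra1995] W. Bosma, H. W. Lenstra, *Complete systems of two addition laws for elliptic
  curves*, J. Number Theory 53 (1995), 229–240: Theorem 2 and §5.
* [SilvermanAEC2009] J. H. Silverman, *The Arithmetic of Elliptic Curves*, 2nd ed., III.2–III.3
  (the group law; Remark 3.6.1 on making the addition morphism explicit).

## Design notes

Mathlib-style: `namespace WeierstrassCurve.Projective`, `W' : Projective R` over a commutative ring,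
local notations `x y z` for the coordinates `0 1 2 : Fin 3`, exactly as in
`Mathlib/AlgebraicGeometry/EllipticCurve/Projective/Formula.lean`.
-/

local notation3 "x" => (0 : Fin 3)

local notation3 "y" => (1 : Fin 3)

local notation3 "z" => (2 : Fin 3)

universe r

namespace WeierstrassCurve.Projective

variable {R : Type r} [CommRing R] (W' : Projective R)

/-! ### The law -/

/-- The `X`-coordinate (weight `11`, 56 terms) of the second addition law of bidegree `(2, 2)`
on a Weierstrass curve (the Bosma–Lenstra law of the point `(0 : 1 : 0)`, normalised to restrict to
Mathlib's doubling law on the diagonal). [cite: BosmaLenstra1995, Theorem 2] -/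
def add₂X (P Q : Fin 3 → R) : R :=
  P y ^ 2 * Q x * Q y + P x * P y * Q y ^ 2 - 3 * W'.a₆ * P z ^ 2 * Q x * Q y
    - 6 * W'.a₆ * P y * P z * Q x * Q z - 6 * W'.a₆ * P x * P z * Q y * Q z
    - 3 * W'.a₆ * P x * P y * Q z ^ 2 - W'.a₄ * P y * P z * Q x ^ 2
    - 2 * W'.a₄ * P x * P z * Q x * Q y - 2 * W'.a₄ * P x * P y * Q x * Q z
    - W'.a₄ * P x ^ 2 * Q y * Q z + W'.a₄ ^ 2 * P z ^ 2 * Q y * Q z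
    + W'.a₄ ^ 2 * P y * P z * Q z ^ 2 + W'.a₃ * P x * P z * Q y ^ 2
    + 2 * W'.a₃ * P x * P y * Q y * Q z - 3 * W'.a₃ * W'.a₆ * P z ^ 2 * Q x * Q z
    - 6 * W'.a₃ * W'.a₆ * P x * P z * Q z ^ 2 - 2 * W'.a₃ * W'.a₄ * P x * P z * Q x * Q z
    - W'.a₃ * W'.a₄ * P x ^ 2 * Q z ^ 2 + W'.a₃ * W'.a₄ ^ 2 * P z ^ 2 * Q z ^ 2
    - W'.a₃ ^ 2 * P z ^ 2 * Q x * Q y - 2 * W'.a₃ ^ 2 * P y * P z * Q x * Q z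
    - W'.a₃ ^ 3 * P z ^ 2 * Q x * Q z - W'.a₃ ^ 3 * P x * P z * Q z ^ 2
    - W'.a₂ * P x * P y * Q x ^ 2 - W'.a₂ * P x ^ 2 * Q x * Q y
    - 4 * W'.a₂ * W'.a₆ * P z ^ 2 * Q y * Q z - 4 * W'.a₂ * W'.a₆ * P y * P z * Q z ^ 2
    - W'.a₂ * W'.a₃ * P x ^ 2 * Q x * Q z - 4 * W'.a₂ * W'.a₃ * W'.a₆ * P z ^ 2 * Q z ^ 2
    - W'.a₂ * W'.a₃ ^ 2 * P z ^ 2 * Q y * Q z - W'.a₂ * W'.a₃ ^ 2 * P y * P z * Q z ^ 2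
    - W'.a₂ * W'.a₃ ^ 3 * P z ^ 2 * Q z ^ 2 + 2 * W'.a₁ * P x * P y * Q x * Q y
    + W'.a₁ * P x ^ 2 * Q y ^ 2 - 3 * W'.a₁ * W'.a₆ * P z ^ 2 * Q x ^ 2
    - 6 * W'.a₁ * W'.a₆ * P x * P z * Q x * Q z - 2 * W'.a₁ * W'.a₄ * P x * P z * Q x ^ 2
    - W'.a₁ * W'.a₄ * P x ^ 2 * Q x * Q z + W'.a₁ * W'.a₄ ^ 2 * P z ^ 2 * Q x * Q z
    - W'.a₁ * W'.a₃ * P y * P z * Q x ^ 2 + W'.a₁ * W'.a₃ * P x ^ 2 * Q y * Q z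
    + W'.a₁ * W'.a₃ * W'.a₄ * P z ^ 2 * Q y * Q z + W'.a₁ * W'.a₃ * W'.a₄ * P y * P z * Q z ^ 2
    - W'.a₁ * W'.a₃ ^ 2 * P z ^ 2 * Q x ^ 2 - 2 * W'.a₁ * W'.a₃ ^ 2 * P x * P z * Q x * Q z
    + W'.a₁ * W'.a₃ ^ 2 * W'.a₄ * P z ^ 2 * Q z ^ 2 - W'.a₁ * W'.a₂ * P x ^ 2 * Q x ^ 2
    - 4 * W'.a₁ * W'.a₂ * W'.a₆ * P z ^ 2 * Q x * Q z
    - W'.a₁ * W'.a₂ * W'.a₃ ^ 2 * P z ^ 2 * Q x * Q z + W'.a₁ ^ 2 * P x ^ 2 * Q x * Q y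
    - W'.a₁ ^ 2 * W'.a₆ * P z ^ 2 * Q y * Q z - W'.a₁ ^ 2 * W'.a₆ * P y * P z * Q z ^ 2
    - W'.a₁ ^ 2 * W'.a₃ * P x * P z * Q x ^ 2 - W'.a₁ ^ 2 * W'.a₃ * W'.a₆ * P z ^ 2 * Q z ^ 2
    + W'.a₁ ^ 2 * W'.a₃ * W'.a₄ * P z ^ 2 * Q x * Q z - W'.a₁ ^ 3 * W'.a₆ * P z ^ 2 * Q x * Q z

/-- The `Y`-coordinate (weight `12`, 74 terms) of the second addition law of bidegree `(2, 2)`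
on a Weierstrass curve (the Bosma–Lenstra law of the point `(0 : 1 : 0)`, normalised to restrict to
Mathlib's doubling law on the diagonal). [cite: BosmaLenstra1995, Theorem 2] -/
def add₂Y (P Q : Fin 3 → R) : R :=
  P y ^ 2 * Q y ^ 2 + 9 * W'.a₆ * P x * P z * Q x ^ 2 + 9 * W'.a₆ * P x ^ 2 * Q x * Q z
    - 9 * W'.a₆ ^ 2 * P z ^ 2 * Q z ^ 2 + 3 * W'.a₄ * P x ^ 2 * Q x ^ 2
    - 3 * W'.a₄ * W'.a₆ * P z ^ 2 * Q x * Q z - 3 * W'.a₄ * W'.a₆ * P x * P z * Q z ^ 2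
    - W'.a₄ ^ 2 * P z ^ 2 * Q x ^ 2 - 4 * W'.a₄ ^ 2 * P x * P z * Q x * Q z
    - W'.a₄ ^ 2 * P x ^ 2 * Q z ^ 2 - W'.a₄ ^ 3 * P z ^ 2 * Q z ^ 2 + W'.a₃ * P y * P z * Q y ^ 2
    - 3 * W'.a₃ * P x ^ 2 * Q x * Q y - 3 * W'.a₃ * W'.a₆ * P z ^ 2 * Q y * Q z
    - W'.a₃ * W'.a₄ * P z ^ 2 * Q x * Q y - 2 * W'.a₃ * W'.a₄ * P x * P z * Q y * Q z
    + 3 * W'.a₃ ^ 2 * P x * P z * Q x ^ 2 - 6 * W'.a₃ ^ 2 * W'.a₆ * P z ^ 2 * Q z ^ 2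
    - W'.a₃ ^ 2 * W'.a₄ * P z ^ 2 * Q x * Q z - 2 * W'.a₃ ^ 2 * W'.a₄ * P x * P z * Q z ^ 2
    - W'.a₃ ^ 3 * P z ^ 2 * Q y * Q z - W'.a₃ ^ 4 * P z ^ 2 * Q z ^ 2
    + 3 * W'.a₂ * W'.a₆ * P z ^ 2 * Q x ^ 2 + 12 * W'.a₂ * W'.a₆ * P x * P z * Q x * Q z
    + 3 * W'.a₂ * W'.a₆ * P x ^ 2 * Q z ^ 2 - W'.a₂ * W'.a₄ * P x * P z * Q x ^ 2
    - W'.a₂ * W'.a₄ * P x ^ 2 * Q x * Q z + 4 * W'.a₂ * W'.a₄ * W'.a₆ * P z ^ 2 * Q z ^ 2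
    - W'.a₂ * W'.a₄ ^ 2 * P z ^ 2 * Q x * Q z - W'.a₂ * W'.a₄ ^ 2 * P x * P z * Q z ^ 2
    - 2 * W'.a₂ * W'.a₃ * P x * P z * Q x * Q y - W'.a₂ * W'.a₃ * P x ^ 2 * Q y * Q z
    + W'.a₂ * W'.a₃ ^ 2 * P z ^ 2 * Q x ^ 2 + 2 * W'.a₂ * W'.a₃ ^ 2 * P x * P z * Q x * Q z
    + W'.a₂ * W'.a₃ ^ 2 * W'.a₄ * P z ^ 2 * Q z ^ 2 - W'.a₂ ^ 2 * P x ^ 2 * Q x ^ 2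
    + 4 * W'.a₂ ^ 2 * W'.a₆ * P z ^ 2 * Q x * Q z + 4 * W'.a₂ ^ 2 * W'.a₆ * P x * P z * Q z ^ 2
    + W'.a₂ ^ 2 * W'.a₃ ^ 2 * P z ^ 2 * Q x * Q z + W'.a₂ ^ 2 * W'.a₃ ^ 2 * P x * P z * Q z ^ 2
    + W'.a₁ * P x * P y * Q y ^ 2 + 3 * W'.a₁ * W'.a₆ * P z ^ 2 * Q x * Q y
    + 6 * W'.a₁ * W'.a₆ * P x * P z * Q y * Q z + 2 * W'.a₁ * W'.a₄ * P x * P z * Q x * Q y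
    + W'.a₁ * W'.a₄ * P x ^ 2 * Q y * Q z - W'.a₁ * W'.a₄ ^ 2 * P z ^ 2 * Q y * Q z
    - 3 * W'.a₁ * W'.a₃ * W'.a₆ * P z ^ 2 * Q x * Q z
    + 3 * W'.a₁ * W'.a₃ * W'.a₆ * P x * P z * Q z ^ 2
    - 2 * W'.a₁ * W'.a₃ * W'.a₄ * P z ^ 2 * Q x ^ 2
    - 4 * W'.a₁ * W'.a₃ * W'.a₄ * P x * P z * Q x * Q z
    - 2 * W'.a₁ * W'.a₃ * W'.a₄ ^ 2 * P z ^ 2 * Q z ^ 2 - W'.a₁ * W'.a₃ ^ 3 * P z ^ 2 * Q x * Q z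
    + W'.a₁ * W'.a₂ * P x ^ 2 * Q x * Q y + 4 * W'.a₁ * W'.a₂ * W'.a₆ * P z ^ 2 * Q y * Q z
    - 2 * W'.a₁ * W'.a₂ * W'.a₃ * P x * P z * Q x ^ 2
    + 4 * W'.a₁ * W'.a₂ * W'.a₃ * W'.a₆ * P z ^ 2 * Q z ^ 2
    - W'.a₁ * W'.a₂ * W'.a₃ * W'.a₄ * P z ^ 2 * Q x * Q z
    - W'.a₁ * W'.a₂ * W'.a₃ * W'.a₄ * P x * P z * Q z ^ 2
    + W'.a₁ * W'.a₂ * W'.a₃ ^ 2 * P z ^ 2 * Q y * Q z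
    + W'.a₁ * W'.a₂ * W'.a₃ ^ 3 * P z ^ 2 * Q z ^ 2 + 3 * W'.a₁ ^ 2 * W'.a₆ * P z ^ 2 * Q x ^ 2
    + 6 * W'.a₁ ^ 2 * W'.a₆ * P x * P z * Q x * Q z + W'.a₁ ^ 2 * W'.a₄ * P x * P z * Q x ^ 2
    + W'.a₁ ^ 2 * W'.a₄ * W'.a₆ * P z ^ 2 * Q z ^ 2 - W'.a₁ ^ 2 * W'.a₄ ^ 2 * P z ^ 2 * Q x * Q z
    - W'.a₁ ^ 2 * W'.a₃ * W'.a₄ * P z ^ 2 * Q y * Q z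
    - W'.a₁ ^ 2 * W'.a₃ ^ 2 * W'.a₄ * P z ^ 2 * Q z ^ 2
    + 5 * W'.a₁ ^ 2 * W'.a₂ * W'.a₆ * P z ^ 2 * Q x * Q z
    + W'.a₁ ^ 2 * W'.a₂ * W'.a₆ * P x * P z * Q z ^ 2
    + W'.a₁ ^ 2 * W'.a₂ * W'.a₃ ^ 2 * P z ^ 2 * Q x * Q z + W'.a₁ ^ 3 * W'.a₆ * P z ^ 2 * Q y * Q z
    + W'.a₁ ^ 3 * W'.a₃ * W'.a₆ * P z ^ 2 * Q z ^ 2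
    - W'.a₁ ^ 3 * W'.a₃ * W'.a₄ * P z ^ 2 * Q x * Q z + W'.a₁ ^ 4 * W'.a₆ * P z ^ 2 * Q x * Q z

/-- The `Z`-coordinate (weight `9`, 43 terms) of the second addition law of bidegree `(2, 2)`
on a Weierstrass curve (the Bosma–Lenstra law of the point `(0 : 1 : 0)`, normalised to restrict to
Mathlib's doubling law on the diagonal). [cite: BosmaLenstra1995, Theorem 2] -/
def add₂Z (P Q : Fin 3 → R) : R :=
  P y * P z * Q y ^ 2 + P y ^ 2 * Q y * Q z + 3 * P x * P y * Q x ^ 2 + 3 * P x ^ 2 * Q x * Q y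
    + 3 * W'.a₆ * P z ^ 2 * Q y * Q z + 3 * W'.a₆ * P y * P z * Q z ^ 2
    + W'.a₄ * P z ^ 2 * Q x * Q y + 2 * W'.a₄ * P y * P z * Q x * Q z
    + 2 * W'.a₄ * P x * P z * Q y * Q z + W'.a₄ * P x * P y * Q z ^ 2 + W'.a₃ * P z ^ 2 * Q y ^ 2
    + 2 * W'.a₃ * P y * P z * Q y * Q z + 3 * W'.a₃ * P x ^ 2 * Q x * Q z
    + 3 * W'.a₃ * W'.a₆ * P z ^ 2 * Q z ^ 2 + W'.a₃ * W'.a₄ * P z ^ 2 * Q x * Q z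
    + 2 * W'.a₃ * W'.a₄ * P x * P z * Q z ^ 2 + 2 * W'.a₃ ^ 2 * P z ^ 2 * Q y * Q z
    + W'.a₃ ^ 2 * P y * P z * Q z ^ 2 + W'.a₃ ^ 3 * P z ^ 2 * Q z ^ 2 + W'.a₂ * P y * P z * Q x ^ 2
    + 2 * W'.a₂ * P x * P z * Q x * Q y + 2 * W'.a₂ * P x * P y * Q x * Q z
    + W'.a₂ * P x ^ 2 * Q y * Q z + 2 * W'.a₂ * W'.a₃ * P x * P z * Q x * Q z
    + W'.a₂ * W'.a₃ * P x ^ 2 * Q z ^ 2 + 2 * W'.a₁ * P y * P z * Q x * Q y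
    + W'.a₁ * P x * P z * Q y ^ 2 + 3 * W'.a₁ * P x ^ 2 * Q x ^ 2
    + 3 * W'.a₁ * W'.a₆ * P z ^ 2 * Q x * Q z + W'.a₁ * W'.a₄ * P z ^ 2 * Q x ^ 2
    + 2 * W'.a₁ * W'.a₄ * P x * P z * Q x * Q z + 2 * W'.a₁ * W'.a₃ * P z ^ 2 * Q x * Q y
    + 2 * W'.a₁ * W'.a₃ * P y * P z * Q x * Q z + 2 * W'.a₁ * W'.a₃ * P x * P z * Q y * Q z
    + 2 * W'.a₁ * W'.a₃ ^ 2 * P z ^ 2 * Q x * Q z + W'.a₁ * W'.a₃ ^ 2 * P x * P z * Q z ^ 2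
    + 2 * W'.a₁ * W'.a₂ * P x * P z * Q x ^ 2 + W'.a₁ * W'.a₂ * P x ^ 2 * Q x * Q z
    + W'.a₁ ^ 2 * P y * P z * Q x ^ 2 + 2 * W'.a₁ ^ 2 * P x * P z * Q x * Q y
    + W'.a₁ ^ 2 * W'.a₃ * P z ^ 2 * Q x ^ 2 + 2 * W'.a₁ ^ 2 * W'.a₃ * P x * P z * Q x * Q z
    + W'.a₁ ^ 3 * P x * P z * Q x ^ 2

/-- The second addition law of bidegree `(2, 2)` as a coordinate vector. [cite: BosmaLenstra1995, Theorem 2] -/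
noncomputable def add₂XYZ (P Q : Fin 3 → R) : Fin 3 → R :=
  ![W'.add₂X P Q, W'.add₂Y P Q, W'.add₂Z P Q]

variable {W'}

/-- Unfolding the `X`-coordinate of `add₂XYZ`. [folklore] -/
lemma add₂XYZ_X (P Q : Fin 3 → R) : W'.add₂XYZ P Q x = W'.add₂X P Q := rfl

/-- Unfolding the `Y`-coordinate of `add₂XYZ`. [folklore] -/
lemma add₂XYZ_Y (P Q : Fin 3 → R) : W'.add₂XYZ P Q y = W'.add₂Y P Q := rfl

/-- Unfolding the `Z`-coordinate of `add₂XYZ`. [folklore] -/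
lemma add₂XYZ_Z (P Q : Fin 3 → R) : W'.add₂XYZ P Q z = W'.add₂Z P Q := rfl

/-! ### Bihomogeneity -/

/-- `add₂X` is bihomogeneous of bidegree `(2, 2)`. [folklore] -/
lemma add₂X_smul (P Q : Fin 3 → R) (u v : R) :
    W'.add₂X (u • P) (v • Q) = (u * v) ^ 2 * W'.add₂X P Q := by
  simp only [add₂X, smul_fin3_ext]
  ring1

/-- `add₂Y` is bihomogeneous of bidegree `(2, 2)`. [folklore] -/
lemma add₂Y_smul (P Q : Fin 3 → R) (u v : R) :
    W'.add₂Y (u • P) (v • Q) = (u * v) ^ 2 * W'.add₂Y P Q := by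
  simp only [add₂Y, smul_fin3_ext]
  ring1

/-- `add₂Z` is bihomogeneous of bidegree `(2, 2)`. [folklore] -/
lemma add₂Z_smul (P Q : Fin 3 → R) (u v : R) :
    W'.add₂Z (u • P) (v • Q) = (u * v) ^ 2 * W'.add₂Z P Q := by
  simp only [add₂Z, smul_fin3_ext]
  ring1

/-- `add₂XYZ` is bihomogeneous of bidegree `(2, 2)`. [folklore] -/
lemma add₂XYZ_smul (P Q : Fin 3 → R) (u v : R) :
    W'.add₂XYZ (u • P) (v • Q) = (u * v) ^ 2 • W'.add₂XYZ P Q := by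
  rw [add₂XYZ, add₂X_smul, add₂Y_smul, add₂Z_smul, smul_fin3, add₂XYZ_X, add₂XYZ_Y, add₂XYZ_Z]

/-! ### On the diagonal the law is the doubling law -/

/-- **`add₂X P P = dblX P`** for `P` on the curve. [cite: BosmaLenstra1995, Theorem 2] -/
lemma add₂X_self {P : Fin 3 → R} (hP : W'.Equation P) : W'.add₂X P P = W'.dblX P := by
  linear_combination (norm := (rw [add₂X, dblX]; ring1))
    (9 * W'.a₃ * P x + 8 * W'.a₂ * P y + 4 * W'.a₂ * W'.a₃ * P z + 4 * W'.a₁ * W'.a₂ * P x + 2 * W'.a₁ ^ 2 * P y + W'.a₁ ^ 2 * W'.a₃ * P z + W'.a₁ ^ 3 * P x) * (equation_iff P).mp hP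

/-- **`add₂Z P P = dblZ P`** for `P` on the curve. [cite: BosmaLenstra1995, Theorem 2] -/
lemma add₂Z_self {P : Fin 3 → R} (hP : W'.Equation P) : W'.add₂Z P P = W'.dblZ P := by
  linear_combination (norm := (rw [add₂Z, dblZ, negY]; ring1))
    (-6 * P y - 3 * W'.a₃ * P z - 3 * W'.a₁ * P x) * (equation_iff P).mp hP

/-- **`add₂Y P P = dblY P`** for `P` on the curve. [cite: BosmaLenstra1995, Theorem 2] -/
lemma add₂Y_self {P : Fin 3 → R} (hP : W'.Equation P) : W'.add₂Y P P = W'.dblY P := by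
  linear_combination (norm := (rw [add₂Y, dblY, negY_eq, dblX, negDblY, dblZ, negY]; ring1))
    (9 * W'.a₆ * P z - 3 * W'.a₄ * P x + 12 * W'.a₃ * P y + 6 * W'.a₃ ^ 2 * P z
      - 4 * W'.a₂ * W'.a₄ * P z - 8 * W'.a₂ ^ 2 * P x - 4 * W'.a₁ * W'.a₂ * P y
      - 4 * W'.a₁ * W'.a₂ * W'.a₃ * P z - W'.a₁ ^ 2 * W'.a₄ * P z - 6 * W'.a₁ ^ 2 * W'.a₂ * P x
      - W'.a₁ ^ 3 * P y - W'.a₁ ^ 3 * W'.a₃ * P z - W'.a₁ ^ 4 * P x) * (equation_iff P).mp hP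

/-- **On the diagonal the second addition law is Mathlib's doubling law**: `add₂XYZ P P = dblXYZ P`
for `P` on the curve; in particular it does not vanish at `(P, P)` for `P` nonsingular (where
Mathlib's `addXYZ P P = 0`). [cite: BosmaLenstra1995, Theorem 2] -/
lemma add₂XYZ_self {P : Fin 3 → R} (hP : W'.Equation P) : W'.add₂XYZ P P = W'.dblXYZ P := by
  rw [add₂XYZ, add₂X_self hP, add₂Y_self hP, add₂Z_self hP, dblXYZ]

end WeierstrassCurve.Projective
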